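import Mathlib.Analysis.Fourier.FiniteAbelian.PontryaginDuality
import Mathlib.RingTheory.RootsOfUnity.Complex
import Mathlib.GroupTheory.Index
import HarnessLib

/-!
# Hallgren 2005 / class numbers under GRH — step Q3b: coordinates of characters with respect to
# generators, and the order of the group from generating characters

Topic `Literature/Computability/Cryptography`; proof companion of `HallgrenClassGroup.lean`
(named fact `Hallgren2005_classNumber_qsolvable_of_GRH`). Real definitions (with bodies) and
theorems; no named fact.

Let `A` be a finite abelian group (additively: `A = Cl(−d)` or the subgroup generated by the chosen
forms), `g_1, …, g_k` generators, and `N` with `N · A = 0`. A character `ψ ∈ Â = AddChar A ℂ` is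
determined by its values `ψ(g_i)`, `N`-th roots of unity, i.e. by the exponents
`c_i(ψ) ∈ ℤ/N` with `ψ(g_i) = e^{2πi c_i/N}` — exactly the data that Kitaev's eigenvalue measurement
followed by continued fractions delivers (`kitaevCircuit_distributionChar`,
`HallgrenClassGroupCharacterSums.lean`). This file proves that `ψ ↦ (c_i(ψ))_i` is an injective
homomorphism `Â → (ℤ/N)^k`, so that the order of the subgroup of `(ℤ/N)^k` generated by the
coordinate vectors of sampled characters (computed by `SubgroupOrder.subgroupOrder`,
`HallgrenClassGroupSubgroupOrder.lean`) is the order of the subgroup of `Â` they generate — and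
`|Â| = |A|` (`AddChar.card_eq`) when they generate `Â`.

* `rootLog N z` — the exponent `c ∈ ℤ/N` of an `N`-th root of unity `z = ζ_N^c` (`0` for other `z`);
  `zeta_pow_val_rootLog`, `natCast_eq_rootLog_of_pow_eq`, `rootLog_mul`, `rootLog_one`;
* `charCoord g N ψ = (rootLog N (ψ (g i)))_i` and the homomorphism `charCoordHom`;
  `charCoordHom_injective` when the `g_i` generate `A`;
* `card_closure_charCoord_eq` — for characters `ψ_1, …, ψ_T` generating `Â`:
  `|⟨charCoord ψ_t⟩| = |A|`.

## References

* A. Yu. Kitaev, arXiv:quant-ph/9511026 (1995), §4 (the stabiliser from the measured characters) [Kitaev1995].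
* K. K. H. Cheung, M. Mosca, QIC 1 (2001), §3 [CheungMosca2001].
* A. M. Childs, W. van Dam, Rev. Mod. Phys. 82 (2010), §5.7 [ChildsVandam2010].
-/

noncomputable section

namespace Literature.Computability.Cryptography.Hallgren2005

open Complex

/-! ### Exponents of roots of unity -/

section RootLog

variable (N : ℕ) [NeZero N]

/-- The primitive `N`-th root of unity `ζ_N = e^{2πi/N}`, as a local notation-free abbreviation in
statements: we write `Complex.exp (2 * π * I / N)` and use `Complex.isPrimitiveRoot_exp`. The
**exponent** of an `N`-th root of unity `z`: the `c ∈ ℤ/N` with `z = ζ_N^c` (and `0` if `z^N ≠ 1`).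
[folklore] -/
def rootLog (z : ℂ) : ZMod N :=
  if hz : z ^ N = 1 then
    ((Classical.choose ((Complex.isPrimitiveRoot_exp N (NeZero.ne N)).eq_pow_of_pow_eq_one hz) : ℕ) :
      ZMod N)
  else 0

/-- Powers of a primitive root agree iff the exponents agree modulo `N`. [folklore] -/
theorem zeta_pow_eq_pow_iff (a b : ℕ) :
    Complex.exp (2 * Real.pi * I / N) ^ a = Complex.exp (2 * Real.pi * I / N) ^ b ↔
      (a : ZMod N) = (b : ZMod N) := by
  set ζ := Complex.exp (2 * Real.pi * I / N) with hζ
  have h : IsPrimitiveRoot ζ N := Complex.isPrimitiveRoot_exp N (NeZero.ne N)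
  have hN : 0 < N := Nat.pos_of_ne_zero (NeZero.ne N)
  have hmod : ∀ a : ℕ, ζ ^ a = ζ ^ (a % N) := fun a => by
    conv_lhs => rw [← Nat.mod_add_div a N, pow_add, pow_mul, h.pow_eq_one, one_pow, mul_one]
  rw [hmod a, hmod b, ZMod.natCast_eq_natCast_iff']
  constructor
  · intro hab
    exact h.pow_inj (Nat.mod_lt a hN) (Nat.mod_lt b hN) hab
  · intro hab; rw [hab]

/-- `ζ_N ^ (rootLog z) = z` for an `N`-th root of unity `z`. [folklore] -/
theorem zeta_pow_val_rootLog {z : ℂ} (hz : z ^ N = 1) :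
    Complex.exp (2 * Real.pi * I / N) ^ (rootLog N z).val = z := by
  have hspec := Classical.choose_spec
    ((Complex.isPrimitiveRoot_exp N (NeZero.ne N)).eq_pow_of_pow_eq_one hz)
  rw [rootLog, dif_pos hz, ZMod.val_cast_of_lt hspec.1]
  exact hspec.2

/-- Uniqueness of the exponent: if `ζ_N^a = z` then `a = rootLog z` in `ℤ/N`. [folklore] -/
theorem natCast_eq_rootLog_of_pow_eq {z : ℂ} {a : ℕ} (ha : Complex.exp (2 * Real.pi * I / N) ^ a = z) :
    (a : ZMod N) = rootLog N z := by
  have hz : z ^ N = 1 := by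
    rw [← ha, ← pow_mul, mul_comm a N, pow_mul, (Complex.isPrimitiveRoot_exp N (NeZero.ne N)).pow_eq_one,
      one_pow]
  have h2 := zeta_pow_val_rootLog N hz
  rw [← ZMod.natCast_zmod_val (rootLog N z), ← zeta_pow_eq_pow_iff N, ha, h2]

/-- `rootLog 1 = 0`. [folklore] -/
theorem rootLog_one : rootLog N (1 : ℂ) = 0 := by
  have := natCast_eq_rootLog_of_pow_eq N (a := 0) (z := 1) (pow_zero _)
  rw [← this, Nat.cast_zero]

/-- **Additivity of the exponent**: `rootLog (z w) = rootLog z + rootLog w` for `N`-th roots of unity.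
[folklore] -/
theorem rootLog_mul {z w : ℂ} (hz : z ^ N = 1) (hw : w ^ N = 1) :
    rootLog N (z * w) = rootLog N z + rootLog N w := by
  have h := natCast_eq_rootLog_of_pow_eq N (a := (rootLog N z).val + (rootLog N w).val) (z := z * w)
    (by rw [pow_add, zeta_pow_val_rootLog N hz, zeta_pow_val_rootLog N hw])
  rw [← h, Nat.cast_add, ZMod.natCast_zmod_val, ZMod.natCast_zmod_val]

omit [NeZero N] in
/-- An `N`-th root of unity has modulus `1`: `z = e^{2πi c/N}` form, as needed to read `rootLog` off an
argument. (Recorded for the accuracy analysis: `arg z = 2π (rootLog z).val / N` modulo `2π`.)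
`ζ_N^c = exp(2πi c / N)`. [folklore] -/
theorem zeta_pow_eq_exp (c : ℕ) :
    Complex.exp (2 * Real.pi * I / N) ^ c = Complex.exp (2 * Real.pi * I * (c / N)) := by
  rw [← Complex.exp_nat_mul]
  congr 1
  field_simp

end RootLog

/-! ### Coordinates of characters -/

section Coordinates

variable {A : Type*} [AddCommGroup A] {k : ℕ} (g : Fin k → A) (N : ℕ) [NeZero N]

omit [NeZero N] in
/-- Characters of a group killed by `N` take values in the `N`-th roots of unity. [folklore] -/
theorem addChar_apply_pow_eq_one (hN : ∀ a : A, N • a = 0) (ψ : AddChar A ℂ) (a : A) :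
    ψ a ^ N = 1 := by
  rw [← AddChar.map_nsmul_eq_pow, hN a, AddChar.map_zero_eq_one]

/-- **The coordinates of a character** with respect to the generators `g`: the exponents
`c_i ∈ ℤ/N` with `ψ(g_i) = ζ_N^{c_i}`. [cite: Kitaev1995, §4 (the measured eigenvalues as exponents)] -/
def charCoord (ψ : AddChar A ℂ) : Fin k → ZMod N := fun i => rootLog N (ψ (g i))

/-- **The coordinate homomorphism `Â → (ℤ/N)^k`** (for `N · A = 0`). [folklore] -/
def charCoordHom (hN : ∀ a : A, N • a = 0) : AddChar A ℂ →+ (Fin k → ZMod N) where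
  toFun := charCoord g N
  map_zero' := by
    funext i
    simp [charCoord, rootLog_one]
  map_add' ψ φ := by
    funext i
    simp only [charCoord, AddChar.add_apply, Pi.add_apply]
    exact rootLog_mul N (addChar_apply_pow_eq_one N hN ψ _) (addChar_apply_pow_eq_one N hN φ _)

/-- `charCoordHom` is `charCoord`. [folklore] -/
@[simp] theorem charCoordHom_apply (hN : ∀ a : A, N • a = 0) (ψ : AddChar A ℂ) :
    charCoordHom g N hN ψ = charCoord g N ψ := rfl

/-- A character with all coordinates `0` is trivial on the generators. [folklore] -/
theorem apply_eq_one_of_charCoord_eq_zero (hN : ∀ a : A, N • a = 0) {ψ : AddChar A ℂ}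
    (h : charCoord g N ψ = 0) (i : Fin k) : ψ (g i) = 1 := by
  have hi : rootLog N (ψ (g i)) = 0 := congrFun h i
  have := zeta_pow_val_rootLog N (addChar_apply_pow_eq_one N hN ψ (g i))
  rw [hi, ZMod.val_zero, pow_zero] at this
  exact this.symm

/-- **Injectivity**: when the `g_i` generate `A`, a character is determined by its coordinates.
[folklore] -/
theorem charCoordHom_injective (hN : ∀ a : A, N • a = 0)
    (hg : AddSubgroup.closure (Set.range g) = ⊤) : Function.Injective (charCoordHom g N hN) := by
  refine (injective_iff_map_eq_zero _).mpr fun ψ hψ => ?_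
  rw [charCoordHom_apply] at hψ
  rw [AddChar.eq_zero_iff]
  intro x
  have hx : x ∈ AddSubgroup.closure (Set.range g) := by rw [hg]; exact AddSubgroup.mem_top x
  induction hx using AddSubgroup.closure_induction with
  | mem y hy =>
    obtain ⟨i, rfl⟩ := hy
    exact apply_eq_one_of_charCoord_eq_zero g N hN hψ i
  | zero => exact AddChar.map_zero_eq_one ψ
  | add y z _ _ hy hz => rw [AddChar.map_add_eq_mul, hy, hz, one_mul]
  | neg y _ hy => rw [AddChar.map_neg_eq_inv, hy, inv_one]

variable [Fintype A]

/-- **The order of the group from generating characters.** If characters `ψ_1, …, ψ_T` generate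
`Â`, the `g_i` generate `A` and `N · A = 0`, then the subgroup of `(ℤ/N)^k` generated by their
coordinate vectors has order `|A|` (`charCoordHom` is injective and `|Â| = |A|`, Mathlib
`AddChar.card_eq`). This is what the post-processing of the class-number algorithm computes
(`SubgroupOrder.subgroupOrder_eq_card_closure`). [cite: CheungMosca2001, §3 (group structure from the sampled characters)] -/
theorem card_closure_charCoord_eq (hN : ∀ a : A, N • a = 0)
    (hg : AddSubgroup.closure (Set.range g) = ⊤) {T : ℕ} (ψ : Fin T → AddChar A ℂ)
    (hψ : AddSubgroup.closure (Set.range ψ) = ⊤) :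
    Nat.card (AddSubgroup.closure (Set.range fun t => charCoord g N (ψ t))) = Fintype.card A := by
  classical
  have hrange : (Set.range fun t => charCoord g N (ψ t)) = (charCoordHom g N hN) '' Set.range ψ := by
    ext v
    simp only [Set.mem_range, Set.mem_image, charCoordHom_apply]
    constructor
    · rintro ⟨t, rfl⟩; exact ⟨ψ t, ⟨t, rfl⟩, rfl⟩
    · rintro ⟨_, ⟨t, rfl⟩, rfl⟩; exact ⟨t, rfl⟩
  rw [hrange, ← AddMonoidHom.map_closure, hψ,
    AddSubgroup.card_map_of_injective (charCoordHom_injective g N hN hg), AddSubgroup.card_top,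
    Nat.card_eq_fintype_card, AddChar.card_eq]

/-- The generation condition in terms of the order: characters `ψ_t` generate `Â` iff the subgroup
of `(ℤ/N)^k` generated by their coordinates has order `|A|` (only the forward direction is used by
the algorithm; the order always DIVIDES `|A|`). [folklore] -/
theorem card_closure_charCoord_dvd (hN : ∀ a : A, N • a = 0)
    (hg : AddSubgroup.closure (Set.range g) = ⊤) {T : ℕ} (ψ : Fin T → AddChar A ℂ) :
    Nat.card (AddSubgroup.closure (Set.range fun t => charCoord g N (ψ t))) ∣ Fintype.card A := by
  classical
  have hrange : (Set.range fun t => charCoord g N (ψ t)) = (charCoordHom g N hN) '' Set.range ψ := by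
    ext v
    simp only [Set.mem_range, Set.mem_image, charCoordHom_apply]
    constructor
    · rintro ⟨t, rfl⟩; exact ⟨ψ t, ⟨t, rfl⟩, rfl⟩
    · rintro ⟨_, ⟨t, rfl⟩, rfl⟩; exact ⟨t, rfl⟩
  rw [hrange, ← AddMonoidHom.map_closure,
    AddSubgroup.card_map_of_injective (charCoordHom_injective g N hN hg), ← AddChar.card_eq (α := A),
    ← Nat.card_eq_fintype_card]
  exact AddSubgroup.card_addSubgroup_dvd_card _

end Coordinates

end Literature.Computability.Cryptography.Hallgren2005

end
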